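import Summits.BirchSwinnertonDyer.BirchSwinnertonDyer.Theorems.GenusKolyvaginAtTwoTorsionCellD0PairTwistSymbols
import Literature.NumberTheory.EllipticCurves.TwoIsogeniesOfSplitTwoTorsion
import Literature.NumberTheory.QuadraticFields.InertSplitLegendreSymbols
import Literature.NumberTheory.EllipticCurves.TwistFamilySelmerGroupCardInvarianceProofs
import Literature.NumberTheory.EllipticCurves.PAdicGrossZagierConstantTermProofs
import HarnessLib

/-!
# D0≤2: reading the hypotheses of LINE 49 «full_vertex» in the currency of the complete `2`-descent

Crux R″ `RankOneTwoTorsionResidualAtTwo` (stmt-27478), LINE 49, stub D0≤2 `FullTorsionGenusSelmerLawUpToTwoAtTwo`.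
The kernel theorems `natCard_selmerGroup_twist_negPrime_eq_eight` (`#Sel⁽²⁾(E^{(−p)}) = 8`) and
`natCard_selmerGroup_twist_pair_eq_four` (`#Sel⁽²⁾(E^{(q₁q₂)}) = 4`) are stated for a curve `E/ℚ` with
`SplitTwoTorsion e₁ e₂ e₃`, a set `S` of primes off which the root differences are units, and Legendre-symbol
conditions at the twisting primes. This file translates the hypotheses of LINE 49 (`HasFullRationalTwoTorsion`,
globally minimal base of conductor `N₀`, `IsFullAdmissible` = "inert in `ℚ(E′[2])` for every `2`-isogenous `E′`")
into that currency:

* §1 `exists_splitTwoTorsion_of_two_torsion_points` — two distinct non-zero rational points killed by `2` give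
  `SplitTwoTorsion e₁ e₂ e₃` with `e₁ < e₂ < e₃` (the `2`-division cubic has the two abscissae as roots; Vieta).
* §2 `padicValRat_sub_roots_eq_zero_of_not_dvd_conductorNorm` — for a GLOBALLY MINIMAL `E/ℚ` with split `2`-torsion
  and an odd prime `ℓ ∤ N_E`: `v_ℓ(eᵢ − eⱼ) = 0` (`4eᵢ ∈ ℤ` by integrality of the minimal model and
  `Δ_min = 16 ∏ (eᵢ − eⱼ)²` is an `ℓ`-unit at a good prime).
* §3 `qrBit_eq_one_of_isInertInSqrt` — Shu–Zhai's `IsInertInSqrt q δ` for a `q`-unit rational `δ` gives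
  `qr_q(δ) = 1`; `qrBit_delta_eq_one_of_forall_isogeny` — "inert in `ℚ(E′[2])` for every `E → E′` of degree `2`"
  gives `qr_q(δ₁) = qr_q(δ₂) = qr_q(δ₃) = 1` (the three `2`-isogenies of `TwoIsogeniesOfSplitTwoTorsion`), hence
  `q ≡ 3 (mod 4)` (`emod_four_eq_three_of_qrBit_delta`).
* §4 `natCard_torsionBy_two_smul_quadraticTwist` — any model `T • E^{(d)}` of a twist of a full-`2`-torsion curve has
  exactly four rational points killed by `2`.

Everything is proved; no LINE 49 statement is restated; BSD is not advanced by this file alone.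

## References

* [SilvermanAEC2009] J. H. Silverman, *The Arithmetic of Elliptic Curves*, 2nd ed., GTM 106, Springer 2009,
  III.§2 (Ex. 3.7), VII.§1, VIII.8, Prop. X.1.4, X.4 Prop. X.4.9.
* [ShuZhai2021] J. Shu, S. Zhai, arXiv:2102.11808, Def. 1.1.
-/

noncomputable section

open scoped Classical

namespace Summit.BirchSwinnertonDyer.BirchSwinnertonDyer.Theorems.GenusKolyvaginAtTwo.TorsionCellD0

open WeierstrassCurve WeierstrassCurve.Affine WeierstrassCurve.Affine.Point
open Literature.NumberTheory.GaloisRepresentations Literature.NumberTheory.EllipticCurves Field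
open Literature.NumberTheory.EllipticCurves.TwoDescentLocal
open Literature.NumberTheory.EllipticCurves.KramerTwoDescent
open IsDedekindDomain NumberField Rat.HeightOneSpectrum Polynomial

/-! ## §1 From two rational `2`-torsion points to `SplitTwoTorsion` -/

section Split

variable {F : Type*} [Field F] [CharZero F] (W : WeierstrassCurve F) [W.IsElliptic]

omit [CharZero F] [W.IsElliptic] in
/-- The abscissa of a rational point killed by `2` is a root of `4x³ + b₂x² + 2b₄x + b₆`.
[cite: SilvermanAEC2009, III.§2 (Ex. 3.7)] -/
theorem cubic_eq_zero_of_two_smul_eq_zero {x y : F} {hP : W.toAffine.Nonsingular x y}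
    (h2 : (2 : ℕ) • (Affine.Point.some x y hP : W.toAffine.Point) = 0) :
    4 * x ^ 3 + W.b₂ * x ^ 2 + 2 * W.b₄ * x + W.b₆ = 0 := by
  have := (W.isRoot_twoTorsionPolynomial_of_add_self_eq_zero (h := hP) (by rwa [two_nsmul] at h2)).2
  simp only [twoTorsionPolynomial, Cubic.toPoly, IsRoot.def, eval_add, eval_mul, eval_C, eval_pow, eval_X] at this
  linear_combination this

omit [W.IsElliptic] in
/-- **Two distinct non-zero rational points killed by `2` give rational `2`-torsion `e₁, e₂, e₃`** (the third root
of the `2`-division cubic by Vieta). [cite: SilvermanAEC2009, III.§2 (Ex. 3.7), Prop. X.1.4] -/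
theorem exists_splitTwoTorsion_of_two_torsion_points {P Q : W.toAffine.Point} (hPQ : P ≠ Q) (hP0 : P ≠ 0) (hQ0 : Q ≠ 0)
    (hP2 : (2 : ℕ) • P = 0) (hQ2 : (2 : ℕ) • Q = 0) :
    ∃ e₁ e₂ e₃ : F, W.toAffine.SplitTwoTorsion e₁ e₂ e₃ := by
  rcases P with _ | ⟨x₁, y₁, h₁⟩
  · exact absurd rfl hP0
  rcases Q with _ | ⟨x₂, y₂, h₂⟩
  · exact absurd rfl hQ0
  have hc₁ := cubic_eq_zero_of_two_smul_eq_zero W hP2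
  have hc₂ := cubic_eq_zero_of_two_smul_eq_zero W hQ2
  have hy₁ := (W.isRoot_twoTorsionPolynomial_of_add_self_eq_zero (h := h₁) (by rwa [two_nsmul] at hP2)).1
  have hy₂ := (W.isRoot_twoTorsionPolynomial_of_add_self_eq_zero (h := h₂) (by rwa [two_nsmul] at hQ2)).1
  -- the abscissae differ (else the points coincide, `y` being determined by `x`)
  have hx : x₁ ≠ x₂ := by
    intro hx
    subst hx
    apply hPQ
    rw [Affine.negY] at hy₁ hy₂
    have : y₁ = y₂ := by
      have h2 : (2 : F) * (y₁ - y₂) = 0 := by linear_combination hy₁ - hy₂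
      exact sub_eq_zero.mp ((mul_eq_zero.mp h2).resolve_left two_ne_zero)
    subst this; rfl
  -- Vieta
  refine ⟨x₁, x₂, -W.b₂ / 4 - x₁ - x₂, ?_, ?_, ?_⟩
  · ring
  · have hsub : (x₁ - x₂) * (4 * (x₁ ^ 2 + x₁ * x₂ + x₂ ^ 2) + W.b₂ * (x₁ + x₂) + 2 * W.b₄) = 0 := by
      linear_combination hc₁ - hc₂
    have h4 := (mul_eq_zero.mp hsub).resolve_left (sub_ne_zero.mpr hx)
    linear_combination (1 / 2 : F) * h4
  · have hsub : (x₁ - x₂) * (4 * (x₁ ^ 2 + x₁ * x₂ + x₂ ^ 2) + W.b₂ * (x₁ + x₂) + 2 * W.b₄) = 0 := by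
      linear_combination hc₁ - hc₂
    have h4 := (mul_eq_zero.mp hsub).resolve_left (sub_ne_zero.mpr hx)
    linear_combination hc₁ - (x₁) * h4

/-- Reordering rational `2`-torsion increasingly (over an ordered field). [cite: SilvermanAEC2009, Prop. X.1.4] -/
theorem exists_splitTwoTorsion_lt {F : Type*} [Field F] [LinearOrder F] [IsStrictOrderedRing F] {W : WeierstrassCurve F}
    [W.IsElliptic] {a b c : F} (h : W.toAffine.SplitTwoTorsion a b c) :
    ∃ e₁ e₂ e₃ : F, e₁ < e₂ ∧ e₂ < e₃ ∧ W.toAffine.SplitTwoTorsion e₁ e₂ e₃ := by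
  have hab := h.ne₁₂
  have hac := h.ne₁₃
  have hbc := h.ne₂₃
  rcases lt_or_gt_of_ne hab with hab | hab <;> rcases lt_or_gt_of_ne hac with hac | hac <;>
    rcases lt_or_gt_of_ne hbc with hbc | hbc
  · exact ⟨a, b, c, hab, hbc, h⟩
  · exact ⟨a, c, b, hac, hbc, h.swap₂₃⟩
  · exact absurd (hab.trans hbc) (lt_asymm hac)
  · exact ⟨c, a, b, hac, hab, h.swap₂₃.swap₁₂⟩
  · exact ⟨b, a, c, hab, hac, h.swap₁₂⟩
  · exact absurd (hac.trans hbc) (lt_asymm hab)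
  · exact ⟨b, c, a, hbc, hac, h.swap₁₂.swap₂₃⟩
  · exact ⟨c, b, a, hbc, hab, h.swap₁₂.swap₂₃.swap₁₂⟩

end Split

/-! ## §2 Root differences of a globally minimal model are units at the good odd primes -/

section Minimal

variable (E : WeierstrassCurve ℚ) [E.IsElliptic] [E.IsGloballyMinimal] {e₁ e₂ e₃ : ℚ}

/-- `v_ℓ(4) = 0` for an odd prime `ℓ`. [folklore] -/
private theorem padicValRat_four {ℓ : ℕ} [hℓ : Fact ℓ.Prime] (hℓ2 : ℓ ≠ 2) : padicValRat ℓ (4 : ℚ) = 0 := by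
  rw [show (4 : ℚ) = ((4 : ℕ) : ℚ) by norm_num, padicValRat.of_nat]
  have : padicValNat ℓ 4 = 0 := padicValNat.eq_zero_of_not_dvd fun hd =>
    hℓ2 ((Nat.prime_dvd_prime_iff_eq hℓ.out Nat.prime_two).mp (hℓ.out.dvd_of_dvd_pow (by simpa using hd : ℓ ∣ 2 ^ 2)))
  rw [this]; rfl

omit [E.IsElliptic] in
/-- `4e` is an integer for a root `e` of the `2`-division cubic of an INTEGRAL model (`4x³ + b₂x² + 2b₄x + b₆`
with `bᵢ ∈ ℤ`: `4e` is a root of the monic `X³ + b₂X² + 8b₄X + 16b₆ ∈ ℤ[X]`). [cite: SilvermanAEC2009, VIII.8 (minimal models are integral), Prop. X.1.4] -/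
theorem exists_intCast_eq_four_mul_root (h : E.toAffine.SplitTwoTorsion e₁ e₂ e₃) : ∃ n : ℤ, (n : ℚ) = 4 * e₁ := by
  set W₀ := integralModelInt E with hW₀
  have hmap : W₀.map (Int.castRingHom ℚ) = E := map_integralModelInt E
  have hb₂ : (W₀.b₂ : ℚ) = E.b₂ := by rw [← hmap, map_b₂]; simp
  have hb₄ : (W₀.b₄ : ℚ) = E.b₄ := by rw [← hmap, map_b₄]; simp
  have hb₆ : (W₀.b₆ : ℚ) = E.b₆ := by rw [← hmap, map_b₆]; simp
  have hint : _root_.IsIntegral ℤ (4 * e₁) := by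
    refine ⟨X ^ 3 + Polynomial.C W₀.b₂ * X ^ 2 + Polynomial.C (8 * W₀.b₄) * X + Polynomial.C (16 * W₀.b₆), by monicity!, ?_⟩
    simp only [eval₂_add, eval₂_mul, eval₂_X_pow, Polynomial.eval₂_C, eval₂_X]
    simp only [eq_intCast]
    push_cast
    rw [hb₂, hb₄, hb₆, show E.b₂ = E.toAffine.b₂ from rfl, show E.b₄ = E.toAffine.b₄ from rfl,
      show E.b₆ = E.toAffine.b₆ from rfl, h.b₂_eq, h.b₄_eq, h.b₆_eq]
    ring
  obtain ⟨n, hn⟩ := IsIntegrallyClosed.isIntegral_iff.mp hint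
  exact ⟨n, by rw [← hn, eq_intCast]⟩

/-- **Root differences of a globally minimal model are `ℓ`-units at every odd prime `ℓ ∤ N`** (good reduction,
`Δ_min = 16 ∏ (eᵢ − eⱼ)²` an `ℓ`-unit, `4eᵢ ∈ ℤ`). [cite: SilvermanAEC2009, VII.§1, VIII.8, Prop. X.1.4] -/
theorem padicValRat_sub_roots_eq_zero_of_not_dvd_conductorNorm (h : E.toAffine.SplitTwoTorsion e₁ e₂ e₃)
    {ℓ : ℕ} [hℓ : Fact ℓ.Prime] (hℓ2 : ℓ ≠ 2) (hℓN : ¬ ℓ ∣ E.conductorNorm ℤ) :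
    padicValRat ℓ (e₁ - e₂) = 0 ∧ padicValRat ℓ (e₁ - e₃) = 0 ∧ padicValRat ℓ (e₂ - e₃) = 0 := by
  -- integrality of `4eᵢ`
  obtain ⟨n₁, hn₁⟩ := exists_intCast_eq_four_mul_root E h
  obtain ⟨n₂, hn₂⟩ := exists_intCast_eq_four_mul_root E h.swap₁₂
  obtain ⟨n₃, hn₃⟩ := exists_intCast_eq_four_mul_root E h.swap₂₃.swap₁₂
  have h4 : padicValRat ℓ (4 : ℚ) = 0 := padicValRat_four hℓ2
  have hnonneg : ∀ {e e' : ℚ} {n n' : ℤ}, (n : ℚ) = 4 * e → (n' : ℚ) = 4 * e' → e ≠ e' → 0 ≤ padicValRat ℓ (e - e') := by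
    intro e e' n n' hn hn' hne
    have hee : e - e' = ((n - n' : ℤ) : ℚ) / 4 := by push_cast; rw [hn, hn']; ring
    have hnn : ((n - n' : ℤ) : ℚ) ≠ 0 := by
      intro h0; apply hne; have : e - e' = 0 := by rw [hee, h0, zero_div]
      exact sub_eq_zero.mp this
    rw [hee, padicValRat.div hnn (by norm_num), h4, sub_zero, padicValRat.of_int]
    exact_mod_cast Nat.zero_le _
  have h12 := hnonneg hn₁ hn₂ h.ne₁₂
  have h13 := hnonneg hn₁ hn₃ h.ne₁₃
  have h23 := hnonneg hn₂ hn₃ h.ne₂₃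
  -- `v_ℓ(Δ_min) = 0`
  have hgood : E.HasGoodReductionAtPrime ℓ := by
    by_contra hbad; exact hℓN ((E.dvd_conductorNorm_iff_not_hasGoodReductionAtPrime ℓ).mpr hbad)
  have hΔdvd := E.not_dvd_minimalDiscriminantInt_of_hasGoodReductionAtPrime ℓ hgood
  have hΔ : padicValRat ℓ E.Δ = 0 := by
    rw [← cast_minimalDiscriminantInt, padicValRat.of_int, padicValInt.eq_zero_of_not_dvd hΔdvd]; rfl
  have hΔ' : E.Δ = 16 * ((e₁ - e₂) * (e₁ - e₃) * (e₂ - e₃)) ^ 2 := h.Δ_eq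
  have he12 : e₁ - e₂ ≠ 0 := sub_ne_zero.mpr h.ne₁₂
  have he13 : e₁ - e₃ ≠ 0 := sub_ne_zero.mpr h.ne₁₃
  have he23 : e₂ - e₃ ≠ 0 := sub_ne_zero.mpr h.ne₂₃
  have h16 : padicValRat ℓ (16 : ℚ) = 0 := by
    rw [show (16 : ℚ) = 4 * 4 by norm_num, padicValRat.mul (by norm_num) (by norm_num), h4, add_zero]
  rw [hΔ', padicValRat.mul (by norm_num) (pow_ne_zero 2 (mul_ne_zero (mul_ne_zero he12 he13) he23)), h16, zero_add,
    padicValRat.pow _, padicValRat.mul (mul_ne_zero he12 he13) he23, padicValRat.mul he12 he13] at hΔ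
  refine ⟨?_, ?_, ?_⟩ <;> omega

end Minimal

/-! ## §3 `IsInertInSqrt` on the `2`-division fields of the `2`-isogenous curves, in residue bits -/

section Inert

/-- `IsInertInSqrt` only depends on the square class: `IsInertInSqrt q (δ s²) → IsInertInSqrt q δ`.
[cite: ShuZhai2021, Def. 1.1] -/
theorem isInertInSqrt_of_mul_sq {q : ℕ} {δ s : ℚ} (h : ShuZhai2021.IsInertInSqrt q (δ * s ^ 2)) :
    ShuZhai2021.IsInertInSqrt q δ := by
  intro F _ _ hF hx
  obtain ⟨x, hx⟩ := hx
  exact h F hF ⟨x * algebraMap ℚ F s, by rw [mul_pow, hx, ← map_pow, ← map_mul]⟩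

/-- And conversely `IsInertInSqrt q δ → IsInertInSqrt q (δ s²)` (`s ≠ 0`). [cite: ShuZhai2021, Def. 1.1] -/
theorem isInertInSqrt_mul_sq {q : ℕ} {δ s : ℚ} (hs : s ≠ 0) (h : ShuZhai2021.IsInertInSqrt q δ) :
    ShuZhai2021.IsInertInSqrt q (δ * s ^ 2) := by
  intro F _ _ hF hx
  obtain ⟨x, hx⟩ := hx
  have hs' : algebraMap ℚ F s ≠ 0 := by rw [map_ne_zero_iff _ (algebraMap ℚ F).injective]; exact hs
  exact h F hF ⟨x / algebraMap ℚ F s, by rw [div_pow, hx, map_mul, map_pow, mul_div_cancel_right₀ _ (pow_ne_zero 2 hs')]⟩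

/-- **`IsInertInSqrt q δ` gives `qr_q(δ) = 1`** when `δ s² = D ∈ ℤ` with `q ∤ D` (`q` odd): `q` is inert in `ℚ(√D)`, so
`(D/q) = −1`. [cite: ShuZhai2021, Def. 1.1] [cite: SilvermanAEC2009, X.§1 (Example X.1.5)] -/
theorem qrBit_eq_one_of_isInertInSqrt {q : ℕ} [hq : Fact q.Prime] (hq2 : q ≠ 2) {δ s : ℚ} {D : ℤ} (hs : s ≠ 0)
    (hD : (D : ℚ) = δ * s ^ 2) (hqD : ¬ (q : ℤ) ∣ D) (h : ShuZhai2021.IsInertInSqrt q δ) : qrBit q δ = 1 := by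
  have hD0 : D ≠ 0 := fun h0 => hqD (by rw [h0]; exact dvd_zero _)
  have hδ0 : δ ≠ 0 := by
    intro h0; apply hD0; have : (D : ℚ) = 0 := by rw [hD, h0, zero_mul]
    exact_mod_cast this
  have hint : ShuZhai2021.IsInertInSqrt q (D : ℚ) := by rw [hD]; exact isInertInSqrt_mul_sq hs h
  have hleg := Literature.NumberTheory.QuadraticFields.Quadratic.legendreSym_eq_neg_one_of_isInertInSqrt_intCast hq2 hqD hint
  have hj : jacobiSym D q = -1 := by rw [← jacobiSym.legendreSym.to_jacobiSym]; exact hleg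
  have hqD' := qrBit_intCast_of_jacobiSym_eq_neg_one (p := q) hj
  rw [hD, qrBit_mul q hδ0 (pow_ne_zero 2 hs), qrBit_sq, add_zero] at hqD'
  exact hqD'

variable (E : WeierstrassCurve ℚ) [E.IsElliptic] {e₁ e₂ e₃ : ℚ}

/-- `q ∤ n - n'` for integers `n = 4e`, `n' = 4e'` with `v_q(e - e') = 0` (`q` odd). [folklore] -/
private theorem not_dvd_sub_of_padicValRat {q : ℕ} [hq : Fact q.Prime] (hq2 : q ≠ 2) {e e' : ℚ} {n n' : ℤ}
    (hn : (n : ℚ) = 4 * e) (hn' : (n' : ℚ) = 4 * e') (hne : e ≠ e') (hv : padicValRat q (e - e') = 0) :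
    ¬ (q : ℤ) ∣ n - n' := by
  intro hd
  have hnn0 : n - n' ≠ 0 := by
    intro h0; apply hne
    have : (4 : ℚ) * (e - e') = 0 := by rw [mul_sub, ← hn, ← hn']; exact_mod_cast h0
    exact sub_eq_zero.mp ((mul_eq_zero.mp this).resolve_left (by norm_num))
  have h4 : padicValRat q (4 : ℚ) = 0 := padicValRat_four hq2
  have hee : e - e' = ((n - n' : ℤ) : ℚ) / 4 := by push_cast; rw [hn, hn']; ring
  rw [hee, padicValRat.div (by exact_mod_cast hnn0) (by norm_num), h4, sub_zero, padicValRat.of_int] at hv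
  have h0 : padicValInt q (n - n') = 0 := by exact_mod_cast hv
  rcases padicValInt.eq_zero_iff.mp h0 with h1 | h1 | h1
  · exact hq.out.ne_one h1
  · exact hnn0 h1
  · exact h1 hd

/-- **"Inert in `ℚ(E′[2])` for every `2`-isogenous `E′`" in residue bits**: for `E/ℚ` with rational `2`-torsion whose
roots have `4eᵢ ∈ ℤ` and unit differences at the odd prime `q`, the condition of `IsFullAdmissible` (Shu–Zhai Def. 1.1
quantified over the `2`-isogenous curves) forces `δ₁ = (e₁-e₂)(e₁-e₃)`, `δ₂`, `δ₃` to be NON-residues at `q` — via the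
three `2`-isogenies `E → E/⟨Tᵢ⟩` with `Δ ≡ δᵢ` (`TwoIsogeniesOfSplitTwoTorsion`). [cite: ShuZhai2021, Def. 1.1]
[cite: SilvermanAEC2009, III.4 Example 4.5, X.4 Prop. X.4.9] -/
theorem qrBit_delta_eq_one_of_forall_isogeny (h : E.toAffine.SplitTwoTorsion e₁ e₂ e₃) {q : ℕ} [hq : Fact q.Prime]
    (hq2 : q ≠ 2) {n₁ n₂ n₃ : ℤ} (hn₁ : (n₁ : ℚ) = 4 * e₁) (hn₂ : (n₂ : ℚ) = 4 * e₂) (hn₃ : (n₃ : ℚ) = 4 * e₃)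
    (hv12 : padicValRat q (e₁ - e₂) = 0) (hv13 : padicValRat q (e₁ - e₃) = 0) (hv23 : padicValRat q (e₂ - e₃) = 0)
    (hadm : ∀ (V : WeierstrassCurve ℚ) [V.IsElliptic], (∃ φ : Isogeny E V, φ.degree = 2) → ShuZhai2021.IsInertInSqrt q V.Δ) :
    qrBit q ((e₁ - e₂) * (e₁ - e₃)) = 1 ∧ qrBit q ((e₂ - e₁) * (e₂ - e₃)) = 1 ∧ qrBit q ((e₃ - e₁) * (e₃ - e₂)) = 1 := by
  have hv21 : padicValRat q (e₂ - e₁) = 0 := by rw [← neg_sub, padicValRat.neg, hv12]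
  have hv31 : padicValRat q (e₃ - e₁) = 0 := by rw [← neg_sub, padicValRat.neg, hv13]
  have hv32 : padicValRat q (e₃ - e₂) = 0 := by rw [← neg_sub, padicValRat.neg, hv23]
  -- generic step for a triple `(a, b, c)` with integers `4a, 4b, 4c`
  have key : ∀ {a b c : ℚ} {na nb nc : ℤ} (h' : E.toAffine.SplitTwoTorsion a b c), (na : ℚ) = 4 * a → (nb : ℚ) = 4 * b →
      (nc : ℚ) = 4 * c → padicValRat q (a - b) = 0 → padicValRat q (a - c) = 0 → qrBit q ((a - b) * (a - c)) = 1 := by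
    intro a b c na nb nc h' hna hnb hnc hab hac
    obtain ⟨V, hV, φ, hdeg, hΔ⟩ := E.exists_isogeny_degree_two_Δ_eq h'
    have hin := hadm V ⟨φ, hdeg⟩
    rw [hΔ, show (256 : ℚ) * ((a - b) * (a - c)) * (b - c) ^ 4 = ((a - b) * (a - c)) * (16 * (b - c) ^ 2) ^ 2 by ring] at hin
    have hbc : b - c ≠ 0 := sub_ne_zero.mpr h'.ne₂₃
    have hin' := isInertInSqrt_of_mul_sq hin
    refine qrBit_eq_one_of_isInertInSqrt hq2 (s := 4) (D := (na - nb) * (na - nc)) (by norm_num) ?_ ?_ hin'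
    · push_cast; rw [hna, hnb, hnc]; ring
    · intro hd
      rcases (Nat.prime_iff_prime_int.mp hq.out).dvd_or_dvd hd with h1 | h1
      · exact not_dvd_sub_of_padicValRat hq2 hna hnb h'.ne₁₂ hab h1
      · exact not_dvd_sub_of_padicValRat hq2 hna hnc h'.ne₁₃ hac h1
  exact ⟨key h hn₁ hn₂ hn₃ hv12 hv13, key h.swap₁₂ hn₂ hn₁ hn₃ hv21 hv23, key h.swap₂₃.swap₁₂ hn₃ hn₁ hn₂ hv31 hv32⟩

/-- **A full-admissible prime is `≡ 3 (mod 4)`**: if `δ₁, δ₂, δ₃` are non-residues at the odd prime `q` then so is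
`−1 = δ₁δ₂δ₃ / ((e₁-e₂)(e₁-e₃)(e₂-e₃))²`. [cite: ShuZhai2021, Def. 1.1] [cite: SilvermanAEC2009, X.§1 (Example X.1.5)] -/
theorem emod_four_eq_three_of_qrBit_delta (h : E.toAffine.SplitTwoTorsion e₁ e₂ e₃) {q : ℕ} [hq : Fact q.Prime] (hq2 : q ≠ 2)
    (h₁ : qrBit q ((e₁ - e₂) * (e₁ - e₃)) = 1) (h₂ : qrBit q ((e₂ - e₁) * (e₂ - e₃)) = 1)
    (h₃ : qrBit q ((e₃ - e₁) * (e₃ - e₂)) = 1) : q % 4 = 3 := by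
  have he12 : e₁ - e₂ ≠ 0 := sub_ne_zero.mpr h.ne₁₂
  have he13 : e₁ - e₃ ≠ 0 := sub_ne_zero.mpr h.ne₁₃
  have he23 : e₂ - e₃ ≠ 0 := sub_ne_zero.mpr h.ne₂₃
  have he21 : e₂ - e₁ ≠ 0 := sub_ne_zero.mpr h.ne₁₂.symm
  have he31 : e₃ - e₁ ≠ 0 := sub_ne_zero.mpr h.ne₁₃.symm
  have he32 : e₃ - e₂ ≠ 0 := sub_ne_zero.mpr h.ne₂₃.symm
  have hprod : qrBit q ((e₁ - e₂) * (e₁ - e₃) * ((e₂ - e₁) * (e₂ - e₃)) * ((e₃ - e₁) * (e₃ - e₂))) = 1 := by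
    rw [qrBit_mul q (mul_ne_zero (mul_ne_zero he12 he13) (mul_ne_zero he21 he23)) (mul_ne_zero he31 he32),
      qrBit_mul q (mul_ne_zero he12 he13) (mul_ne_zero he21 he23), h₁, h₂, h₃]; decide
  have hm1 : qrBit q (-1 : ℚ) = 1 := by
    have : (e₁ - e₂) * (e₁ - e₃) * ((e₂ - e₁) * (e₂ - e₃)) * ((e₃ - e₁) * (e₃ - e₂)) =
        (-1) * ((e₁ - e₂) * (e₁ - e₃) * (e₂ - e₃)) ^ 2 := by ring
    rw [this, qrBit_mul q (by norm_num) (pow_ne_zero 2 (mul_ne_zero (mul_ne_zero he12 he13) he23)), qrBit_sq, add_zero] at hprod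
    exact hprod
  by_contra h4
  have hodd := Nat.odd_iff.mp (hq.out.odd_of_ne_two hq2)
  have h41 : q % 4 = 1 := by omega
  have hj : jacobiSym (-1) q = 1 := by
    rw [← jacobiSym.legendreSym.to_jacobiSym, legendreSym.at_neg_one hq2, ZMod.χ₄_nat_eq_if_mod_four, if_neg (by omega), if_pos h41]
  have := qrBit_intCast_of_jacobiSym_eq_one (p := q) hj
  push_cast at this
  rw [this] at hm1
  exact zero_ne_one hm1

end Inert

/-! ## §4 Four rational `2`-torsion points on every model of a twist -/

section TorsionCount

variable (E : WeierstrassCurve ℚ) [E.IsElliptic] {e₁ e₂ e₃ : ℚ}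

/-- **Every model `T • E^{(d)}` of a quadratic twist of a curve with full rational `2`-torsion has exactly four
rational points killed by `2`.** [cite: SilvermanAEC2009, III.§2 (Ex. 3.7), Prop. X.1.4] -/
theorem natCard_torsionBy_two_smul_quadraticTwist [inst : DecidableEq ℚ] (h : E.toAffine.SplitTwoTorsion e₁ e₂ e₃) {d : ℚ}
    (hd : d ≠ 0) (T : VariableChange ℚ) :
    Nat.card (AddSubgroup.torsionBy (T • E.quadraticTwist d).toAffine.Point ((2 : ℕ) : ℤ)) = 4 := by
  have e : inst = fun a b => Classical.propDecidable (a = b) := Subsingleton.elim _ _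
  subst e
  haveI := E.isElliptic_quadraticTwist hd
  rw [natCard_torsionBy_point_smul, show ((2 : ℕ) : ℤ) = 2 from rfl]
  exact (E.quadraticTwist d).natCard_torsionBy_two_eq_four (inst := fun a b => Classical.propDecidable (a = b)) (h.quadraticTwist d)

end TorsionCount

end Summit.BirchSwinnertonDyer.BirchSwinnertonDyer.Theorems.GenusKolyvaginAtTwo.TorsionCellD0

end
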